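import Summits.Ventures.PackingBounds.SphericalCodes.DegreeThreeBound

/-!
# Equality in the degree-three LP bound: balanced codes and the valency equations

Framing: lottery ticket; floor = certified bounds/negative ranges. Venture `PackingBounds`
(cell `pub-packcert`), spherical-code family; STRUCTURE lemma behind the `L₃ − 1` rows of the
cell's standard-angle grid (cells whose certified Delsarte value is Levenshtein's `L₃(n, s)`, an
integer, but whose forced valencies are not integers).

**Theorem (equality case of the cubic Delsarte certificate; Delsarte–Goethals–Seidel 1977 §4,
Levenshtein 1992, Boyvalenkov–Landgev 1995).** Let `f(t) = (t - s)(t + a)²` be admissible for the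
linear programming bound on `S^{n-1}` (`n = 2μ + 2`, `μ > 0`; Gegenbauer coefficients `f_k ≥ 0`,
here with `f_1 > 0`), and let `C ⊂ S^{n-1}` be a code with pairwise inner products `≤ s` attaining the
bound: `|C| · f_0 = f(1)`. Then
* (`DelsarteLP.sum_eq_zero_of_card_mul_eq`, tree) every inner product of distinct points is a root of
  `f`, i.e. equals `s` or `-a`;
* (design half, `k = 1`: `Σ_{x,y} C_1^{μ}(⟨x,y⟩) = 0`, tree) the code is BALANCED, `Σ_{x ∈ C} x = 0`,
  hence `Σ_{y ∈ C} ⟨x, y⟩ = 0` for every `x ∈ C` (`sum_inner_eq_zero_of_card_mul_eq`);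
* consequently the valencies `A(x) = #{y : ⟨x,y⟩ = s}`, `B(x) = #{y : ⟨x,y⟩ = -a}` of EVERY point
  satisfy `A + B = |C| - 1` and `1 + s·A - a·B = 0` (`degree_three_valency`).
When this `2 × 2` system has no solution in natural numbers, no code attains the bound and
`A(n, s) ≤ f(1)/f_0 - 1` (`degree_three_card_le_of_no_valency`; instances in `SphericalCodes/LevenshteinThreeMinusOne.lean`).

## References
* P. Delsarte, J. M. Goethals, J. J. Seidel, *Spherical codes and designs*, Geom. Dedicata 6 (1977)
  363–388, §4 and Thm. 5.? (codes attaining the LP bound carry designs). [`DelsarteGoethalsSeidel1977`]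
* P. Boyvalenkov, I. Landgev, *On maximal spherical codes I*, LNCS 948 (1995) 158–168 (distance
  distributions of codes attaining `L₃`).
* J. H. Conway, N. J. A. Sloane, *Sphere Packings, Lattices and Groups*, Ch. 9 §3, Ch. 14. [`ConwaySloane1999`]
-/

noncomputable section

namespace Summit.Ventures.PackingBounds.SphericalCodes

open Finset Literature.Analysis.SpecialFunctions Literature.Geometry.DiscreteGeometry
open scoped RealInnerProductSpace

/-- **LP-sharp codes with `f₁ > 0` are balanced**: if a code `C ⊂ S^{n-1}` with pairwise inner
products `≤ s` attains the linear programming bound `|C| · f_0 = f(1)` for an admissible `f` of degree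
`d ≥ 1` with `f_1 > 0`, then `Σ_{y ∈ C} ⟨x, y⟩ = 0` for every vector `x` (i.e. `Σ_{y ∈ C} y = 0`: the
degree-one design condition `Σ_{x,y} C_1^{μ}(⟨x,y⟩) = 2μ ‖Σ_x x‖² = 0`).
(Delsarte–Goethals–Seidel 1977 §4; design half of complementary slackness.) -/
theorem sum_inner_eq_zero_of_card_mul_eq {n : ℕ} {μ : ℝ} (hn : (n : ℝ) = 2 * μ + 2) (hμ : 0 < μ)
    (d : ℕ) (f : ℕ → ℝ) (hf : ∀ k, 0 ≤ f k) (s : ℝ)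
    (hF : ∀ t : ℝ, -1 ≤ t → t ≤ s → ∑ k ∈ range (d + 1), f k * gegenbauerSum μ k t ≤ 0)
    (C : Finset (EuclideanSpace ℝ (Fin n))) (h1 : ∀ x ∈ C, ‖x‖ = 1)
    (h2 : ∀ x ∈ C, ∀ y ∈ C, x ≠ y → inner ℝ x y ≤ s)
    (heq : (C.card : ℝ) * f 0 = ∑ k ∈ range (d + 1), f k * gegenbauerSum μ k 1)
    (hd : 1 ≤ d) (hf1 : 0 < f 1) (x : EuclideanSpace ℝ (Fin n)) :
    ∑ y ∈ C, inner ℝ x y = 0 := by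
  classical
  have hinner : ∀ a b : EuclideanSpace ℝ (Fin n), inner ℝ a b = ∑ j, a j * b j := fun a b => by
    simp [PiLp.inner_apply, mul_comm]
  set xs : C → Fin n → ℝ := fun a j => (a : EuclideanSpace ℝ (Fin n)) j with hxs
  have hunit : ∀ a : C, ∑ j, xs a j ^ 2 = 1 := fun a => by
    rw [← EuclideanSpace.real_norm_sq_eq, h1 a a.2, one_pow]
  have hsep : ∀ a b : C, a ≠ b → ∑ j, xs a j * xs b j ≤ s := fun a b hab => by
    have hne : (a : EuclideanSpace ℝ (Fin n)) ≠ b := fun h => hab (Subtype.ext h)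
    have h := h2 a a.2 b b.2 hne
    rwa [hinner] at h
  have heq' : (Fintype.card C : ℝ) * f 0 = ∑ k ∈ range (d + 1), f k * gegenbauerSum μ k 1 := by
    simpa [Fintype.card_coe] using heq
  have key := DelsarteLP.sum_sum_gegenbauerSum_eq_zero_of_card_mul_eq_coord hn hμ d f hf s hF xs
    hunit hsep heq' (k := 1) (Finset.mem_range.2 (by omega)) le_rfl hf1
  -- `Σ_{a,b} 2μ ⟨x_a,x_b⟩ = 0`, i.e. `Σ_j (Σ_a x_{a,j})² = 0`
  simp only [gegenbauerSum_one] at key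
  have hsum : ∑ a : C, ∑ b : C, ∑ j, xs a j * xs b j = 0 := by
    have h2μ : (2 : ℝ) * μ ≠ 0 := by positivity
    have : 2 * μ * ∑ a : C, ∑ b : C, ∑ j, xs a j * xs b j = 0 := by
      rw [Finset.mul_sum]
      simpa [Finset.mul_sum] using key
    exact (mul_eq_zero.1 this).resolve_left h2μ
  have hsq : ∑ j, (∑ a : C, xs a j) ^ 2 = 0 := by
    have hre : ∑ j, (∑ a : C, xs a j) ^ 2 = ∑ a : C, ∑ b : C, ∑ j, xs a j * xs b j := by
      calc ∑ j, (∑ a : C, xs a j) ^ 2 = ∑ j, ∑ a : C, ∑ b : C, xs a j * xs b j :=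
            Finset.sum_congr rfl fun j _ => by rw [sq, Finset.sum_mul_sum]
        _ = ∑ a : C, ∑ j, ∑ b : C, xs a j * xs b j := Finset.sum_comm
        _ = ∑ a : C, ∑ b : C, ∑ j, xs a j * xs b j :=
            Finset.sum_congr rfl fun a _ => Finset.sum_comm
    rw [hre]; exact hsum
  have hcoord : ∀ j, ∑ a : C, xs a j = 0 := fun j => by
    have := (Finset.sum_eq_zero_iff_of_nonneg fun j _ => sq_nonneg (∑ a : C, xs a j)).1 hsq j
      (Finset.mem_univ j)
    exact pow_eq_zero_iff (n := 2) (by norm_num) |>.1 this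
  -- per point: `Σ_y ⟨x,y⟩ = Σ_j x_j (Σ_y y_j) = 0`
  calc ∑ y ∈ C, inner ℝ x y = ∑ b : C, inner ℝ x (b : EuclideanSpace ℝ (Fin n)) :=
        (Finset.sum_coe_sort C (fun y => inner ℝ x y)).symm
    _ = ∑ b : C, ∑ j, x j * xs b j := Finset.sum_congr rfl fun b _ => by rw [hinner]
    _ = ∑ j, x j * ∑ b : C, xs b j := by
        rw [Finset.sum_comm]; exact Finset.sum_congr rfl fun j _ => by rw [Finset.mul_sum]
    _ = 0 := Finset.sum_eq_zero fun j _ => by rw [hcoord j, mul_zero]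

/-- **Valency equations at a sharp cubic certificate.** Let `f(t) = (t - s)(t + a)²` with
`s ≤ 2a`, `f_1 = (3/(2(μ+2)) + a² - 2as)/(2μ) > 0`, `f_0 = (2a - s)/(2μ + 2) - a² s ≥ 0`
(`n = 2μ + 2`, `μ > 0`), `s ≠ -a`, and let `C ⊂ S^{n-1}` have pairwise inner products `≤ s` and
attain the bound, `|C| · f_0 = f(1) = (1 - s)(1 + a)²`. Then for EVERY `x ∈ C` the valencies
`A = #{y ∈ C ∖ {x} : ⟨x,y⟩ = s}` and `B = #{y ∈ C ∖ {x} : ⟨x,y⟩ = -a}` satisfy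
`s·A - a·B + 1 = 0` and `A + B + 1 = |C|` (all inner products are roots of `f`; the code is balanced).
(Equality case of the Delsarte–Goethals–Seidel bound for the cubic; distance distribution of codes
attaining Levenshtein's `L₃`, Boyvalenkov–Landgev 1995.) -/
theorem degree_three_valency {n : ℕ} {μ : ℝ} (hnμ : (n : ℝ) = 2 * μ + 2) (hμ : 0 < μ)
    (s a : ℝ) (has : s ≤ 2 * a) (hf1 : 0 < 3 / (2 * (μ + 2)) + a ^ 2 - 2 * a * s)
    (hf0 : 0 ≤ (2 * a - s) / (2 * μ + 2) - a ^ 2 * s) (hsa : s ≠ -a)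
    (C : Finset (EuclideanSpace ℝ (Fin n)))
    (h1 : ∀ x ∈ C, ‖x‖ = 1) (h2 : ∀ x ∈ C, ∀ y ∈ C, x ≠ y → inner ℝ x y ≤ s)
    (heq : (C.card : ℝ) * ((2 * a - s) / (2 * μ + 2) - a ^ 2 * s) = (1 - s) * (1 + a) ^ 2)
    {x : EuclideanSpace ℝ (Fin n)} (hx : x ∈ C) :
    (((C.erase x).filter fun y => inner ℝ x y = s).card : ℝ) * s
        - (((C.erase x).filter fun y => inner ℝ x y = -a).card : ℝ) * a + 1 = 0 ∧
      ((C.erase x).filter fun y => inner ℝ x y = s).card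
        + ((C.erase x).filter fun y => inner ℝ x y = -a).card + 1 = C.card := by
  classical
  have hμ1 : (0 : ℝ) < μ + 1 := by linarith
  have hμ2 : (0 : ℝ) < μ + 2 := by linarith
  have hμne : μ ≠ 0 := hμ.ne'
  have hμ1ne : μ + 1 ≠ 0 := hμ1.ne'
  have hμ2ne : μ + 2 ≠ 0 := hμ2.ne'
  have h2μ2 : (2 : ℝ) * μ + 2 ≠ 0 := by positivity
  have hC2 : ∀ t : ℝ, gegenbauerSum μ 2 t = 2 * μ * (μ + 1) * t ^ 2 - μ := by
    intro t
    simp [gegenbauerSum, gegenbauerCoeff, Finset.sum_range_succ, Finset.prod_range_succ,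
      Nat.factorial]
    ring
  have hC3 : ∀ t : ℝ, gegenbauerSum μ 3 t =
      4 / 3 * μ * (μ + 1) * (μ + 2) * t ^ 3 - 2 * μ * (μ + 1) * t := by
    intro t
    simp [gegenbauerSum, gegenbauerCoeff, Finset.sum_range_succ, Finset.prod_range_succ,
      Nat.factorial]
    ring
  -- the cubic certificate and its Gegenbauer coefficients
  set f : ℕ → ℝ := fun k => match k with
      | 0 => (2 * a - s) / (2 * μ + 2) - a ^ 2 * s
      | 1 => (a ^ 2 - 2 * a * s) / (2 * μ) + 3 / (4 * μ * (μ + 2))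
      | 2 => (2 * a - s) / (2 * μ * (μ + 1))
      | 3 => 3 / (4 * μ * (μ + 1) * (μ + 2))
      | _ => 0 with hfdef
  have hpoly : ∀ t : ℝ, ∑ k ∈ range (3 + 1), f k * gegenbauerSum μ k t = (t - s) * (t + a) ^ 2 := by
    intro t
    simp only [hfdef, Finset.sum_range_succ, Finset.sum_range_zero, zero_add, gegenbauerSum_zero,
      gegenbauerSum_one, hC2, hC3]
    field_simp
    ring
  have hf1' : 0 < f 1 := by
    show 0 < (a ^ 2 - 2 * a * s) / (2 * μ) + 3 / (4 * μ * (μ + 2))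
    have : (a ^ 2 - 2 * a * s) / (2 * μ) + 3 / (4 * μ * (μ + 2)) =
        (3 / (2 * (μ + 2)) + a ^ 2 - 2 * a * s) / (2 * μ) := by
      field_simp
      ring
    rw [this]
    positivity
  have hf : ∀ k, 0 ≤ f k := by
    intro k
    show 0 ≤ (match k with
      | 0 => (2 * a - s) / (2 * μ + 2) - a ^ 2 * s
      | 1 => (a ^ 2 - 2 * a * s) / (2 * μ) + 3 / (4 * μ * (μ + 2))
      | 2 => (2 * a - s) / (2 * μ * (μ + 1))
      | 3 => 3 / (4 * μ * (μ + 1) * (μ + 2))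
      | _ => 0)
    split
    · exact hf0
    · exact hf1'.le
    · have : 0 ≤ 2 * a - s := by linarith
      positivity
    · positivity
    · exact le_refl 0
  have hF : ∀ t : ℝ, -1 ≤ t → t ≤ s → ∑ k ∈ range (3 + 1), f k * gegenbauerSum μ k t ≤ 0 := by
    intro t ht1 ht2
    rw [hpoly]
    exact mul_nonpos_of_nonpos_of_nonneg (by linarith) (sq_nonneg _)
  have heq' : (C.card : ℝ) * f 0 = ∑ k ∈ range (3 + 1), f k * gegenbauerSum μ k 1 := by
    rw [hpoly]; exact heq
  -- (1) inner products are roots of `f`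
  have hroots : ∀ y ∈ C.erase x, inner ℝ x y = s ∨ inner ℝ x y = -a := by
    intro y hy
    have hyC : y ∈ C := Finset.mem_of_mem_erase hy
    have hxy : x ≠ y := (Finset.ne_of_mem_erase hy).symm
    have h0 := DelsarteLP.sum_eq_zero_of_card_mul_eq hnμ hμ 3 f hf s hF C h1 h2 heq' hx hyC hxy
    rw [hpoly] at h0
    rcases mul_eq_zero.1 h0 with h | h
    · left; linarith
    · right
      have := pow_eq_zero_iff (n := 2) (by norm_num) |>.1 h
      linarith
  -- (2) the code is balanced
  have hbal : ∑ y ∈ C, inner ℝ x y = 0 :=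
    sum_inner_eq_zero_of_card_mul_eq hnμ hμ 3 f hf s hF C h1 h2 heq' (by norm_num) hf1' x
  -- (3) bookkeeping on `C.erase x`
  set P := (C.erase x).filter fun y => inner ℝ x y = s with hP
  set Q := (C.erase x).filter fun y => inner ℝ x y = -a with hQ
  have hQ' : Q = (C.erase x).filter fun y => ¬ inner ℝ x y = s := by
    rw [hQ]
    refine Finset.filter_congr fun y hy => ?_
    constructor
    · intro h h'; exact hsa (h'.symm.trans h)
    · intro h; exact (hroots y hy).resolve_left h
  have hcard : P.card + Q.card = (C.erase x).card := by
    rw [hQ', hP]; exact Finset.card_filter_add_card_filter_not _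
  have hcardC : (C.erase x).card + 1 = C.card := Finset.card_erase_add_one hx
  have hxx : inner ℝ x x = 1 := by
    rw [real_inner_self_eq_norm_sq, h1 x hx, one_pow]
  have hsplit : ∑ y ∈ C, inner ℝ x y = 1 + ∑ y ∈ C.erase x, inner ℝ x y := by
    rw [← Finset.add_sum_erase C _ hx, hxx]
  have hPQ : ∑ y ∈ C.erase x, inner ℝ x y = (P.card : ℝ) * s + (Q.card : ℝ) * (-a) := by
    rw [← Finset.sum_filter_add_sum_filter_not (C.erase x) (fun y => inner ℝ x y = s), ← hQ', ← hP]
    have hPs : ∑ y ∈ P, inner ℝ x y = (P.card : ℝ) * s := by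
      rw [Finset.sum_congr rfl fun y hy => (Finset.mem_filter.1 hy).2, Finset.sum_const, nsmul_eq_mul]
    have hQs : ∑ y ∈ Q, inner ℝ x y = (Q.card : ℝ) * (-a) := by
      rw [Finset.sum_congr rfl fun y hy => (Finset.mem_filter.1 hy).2, Finset.sum_const,
        nsmul_eq_mul]
    rw [hPs, hQs]
  refine ⟨?_, ?_⟩
  · have := hbal
    rw [hsplit, hPQ] at this
    linarith
  · omega

/-- **No code attains a sharp cubic certificate whose valency equations have no solution in
natural numbers.** With `f(t) = (t - s)(t + a)²` admissible as in `degree_three_valency`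
(`f_0 > 0`, `f_1 > 0`) and `N · f_0 = f(1)` for a natural number `N ≥ 1`: if no `A, B ∈ ℕ` with
`A + B + 1 = N` satisfy `s·A - a·B + 1 = 0`, then every code `C ⊂ S^{n-1}` with pairwise inner
products `≤ s` has `|C| ≤ N - 1` (the LP bound gives `|C| ≤ N`, and `|C| = N` would force the
valency equations at any point of `C`). This is the integrality test behind Boyvalenkov–Landgev's
list of parameters at which Levenshtein's bound `L₃(n, s)` cannot be attained.
(Delsarte–Goethals–Seidel 1977 §4 equality case; Boyvalenkov–Landgev 1995.) -/
theorem degree_three_card_le_of_no_valency {n : ℕ} {μ : ℝ} (hnμ : (n : ℝ) = 2 * μ + 2) (hμ : 0 < μ)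
    (s a : ℝ) (has : s ≤ 2 * a) (hf1 : 0 < 3 / (2 * (μ + 2)) + a ^ 2 - 2 * a * s)
    (hf0 : 0 < (2 * a - s) / (2 * μ + 2) - a ^ 2 * s) (hsa : s ≠ -a) (N : ℕ) (hN : 1 ≤ N)
    (hval : (N : ℝ) * ((2 * a - s) / (2 * μ + 2) - a ^ 2 * s) = (1 - s) * (1 + a) ^ 2)
    (hno : ∀ A B : ℕ, A + B + 1 = N → (A : ℝ) * s - (B : ℝ) * a + 1 ≠ 0)
    (C : Finset (EuclideanSpace ℝ (Fin n)))
    (h1 : ∀ x ∈ C, ‖x‖ = 1) (h2 : ∀ x ∈ C, ∀ y ∈ C, x ≠ y → inner ℝ x y ≤ s) :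
    C.card + 1 ≤ N := by
  have hle := degree_three_card_mul_le_aux hnμ hμ s a has hf1.le hf0.le C h1 h2
  rw [← hval] at hle
  have hcardle : (C.card : ℝ) ≤ N := le_of_mul_le_mul_right hle hf0
  have hC : C.card ≤ N := by exact_mod_cast hcardle
  rcases hC.lt_or_eq with hlt | heqN
  · omega
  · exfalso
    obtain ⟨x, hx⟩ := Finset.card_pos.1 (by omega : 0 < C.card)
    have heq : (C.card : ℝ) * ((2 * a - s) / (2 * μ + 2) - a ^ 2 * s) = (1 - s) * (1 + a) ^ 2 := by
      rw [heqN]; exact hval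
    obtain ⟨hv, hc⟩ := degree_three_valency hnμ hμ s a has hf1 hf0.le hsa C h1 h2 heq hx
    exact hno _ _ (hc.trans heqN) hv

end Summit.Ventures.PackingBounds.SphericalCodes

end
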